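import Literature.MathematicalPhysics.QuantumFieldTheory.Balaban1983to89.B9Thm312WholeRightStepFrom3131
import Literature.MathematicalPhysics.QuantumFieldTheory.Balaban1983to89.B9RWSumsDefinitePinsPairM

/-!
# BalabanUVNodes ∕ N06 ([B9], `Dag.B9_main`) — ROWS 20–21's DIRECTED ∕ HÖLDER-PROBE PERTURBATION STEPS `StepDir` DERIVED AT def-Y's MEMBERS
# FROM THE (DERIVED) «THEOREM 3.3 FOR G₀» LAYER AND THE (3.131)∕(3.137) LETTERS, THE STEP CONSTANTS θ_D, θ_H CHOSEN

Track A of `YM-PLAN.md` (cell `pub-ymgap`, HUMAN RULING D-0062), node **N06** = [Balaban1985BackgroundPropagators] Thms 3.1–3.15;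
seat `pub-ymgap-dag-n06-d` (s2, «knit N06 at the ₁₁ record»).  A HELPER for the stage-11 certificate editions ≥ 16 — the LAYER AFTER
`N06G0LayerFromThm310D.g0_layer_of_thm310_core`.

WHAT.  Up to edition 15 the certificate displays, for rows 20–21 (Theorems 3.12–3.13), n06-l's `StepDir` schema: the ten block majorants
θ_D·e^{−δ_Kd}, θ_H·e^{−δ_Kd} of the perturbation steps K′ = G₀Δ′_π, K′₁ = G₀(Δ′_π + Δ⁽²⁾_π) composed with the directional derivatives ∇_{U,ν},
their Hölder probes Φ^X_β, Φ^Y_β and the input-class right forms (print p. 421: *"One of the three derivatives there has to be applied either to an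
expression on the right, or on the left, of Δ′_π"*; p. 422: *"each operator Δ′_π provides the small factor α₀"*; p. 423's displayed pattern).
n06-l g12's `B9Thm312WholeStepDirFrom3131.stepDir_of_letters3131` + `B9Thm312WholeRightStepFrom3131.stepDir_of_letters3131LR` PROVE all ten at
one member and one U from: Theorem 3.3 for G₀ direction-indexed (`Thm33G0Dir`, `Thm33G0DirR.e2d` — DERIVED from rows 18–19 since edition 13),
the letter schemas `Letters313H ∕ Letters313DM` (displayed for row 21), `Letters3131 ∕ Letters3131H` (displayed since editions 13–14), and the NEW
displayed letter schemas `Thm33G0DirX` (the zeroth-order X-probe of G₀ and the probe of ∇G₀D), `Thm33G0DivR` (the (3.44)-type members D\*G₀∇\*,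
D\*G₀D with the adjoint gauge-mode derivative on the left), `Letters3131R` (the right split Δ′_π = T_a′ + T_b′·D\*), plus the domination of |λ| by
the input norms (`Letters313IM.domX ∕ locX`, displayed), [4] (2.61) and p. 398's member facts — for EVERY θ_D ≧ 2(B₀ + κB₃)·t·c and θ_H above four
β- ∕ ε-UNIFORM dominations (n06-l's located remark U2: the derived probe steps need β-uniform bounds on the Hölder majorant letters).
THIS FILE knits that at the members, AFTER the G₀ layer: ★★ `stepDir_layer_of_letters` takes the core helper's OUTPUT families in its regime (M₀, a₀)
— `LeftStep` at θ_D, `Thm33G0Dir` (constants B₀, B_h), `Thm33G0DirR` — with the signs and the β-uniform bound `B_h β ≦ BhM` it delivers, the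
certificate's displayed schemas in Theorem 3.12's regime (M₁₂, a₁₂) ⊇ (M₀, a₀) (`hLH3 hDM hX hdiv hdomX hlocX hL3131 hL3131H hR hstepL2`), the
β- ∕ ε-uniform bounds `BhDM BxM Bx0M BdXM BiDM` on the displayed majorant letters, and CHOOSES θ_D′ := max(θ_D, 2(B₀ + κ₁₃⁺B₃)·t₁₂·c) and θ_H :=
max of the four dominations at its own row-sum constant c (n06-i `rowSum261_geo9Y` at the rate σ_S) and member facts (n06-k `lemma21Pack_geo9Y`),
above a threshold M₀′ ≧ M₀; output: `LeftStep` weakened to θ_D′ and `StepDir θ_D′ θ_H ∧ StepL2` in the regime (M₀′, a₀) — the shapes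
`N06Thm312313AtPinsPairM.t312_t313_of_pins_pairM` consumes as `hleft12` and `hstepC`.
HONEST FRAMING.  Kernel bookkeeping (thresholds, two maxima, one application of n06-l's theorem per member, four arithmetic dominations);
COUNT-NEUTRAL; nothing of [B9] asserted — the letter schemas remain displayed hypotheses about the genuine operators; N06 NOT discharged.  One finite
𝕋⁴ programme at fixed `ε` — NOT continuum, NOT OS, NOT the mass gap ∕ Clay.  0 `def`, 0 `sorry`.
-/

noncomputable section

namespace Summit.QuantumFields.YangMills.BalabanUVNodes.N06StepDirLayerAtPins

open Literature.MathematicalPhysics.QuantumFieldTheory.Balaban1983to89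
open Literature.MathematicalPhysics.QuantumFieldTheory.Balaban1983to89.B9Thm34Ext (toB6)
open Literature.MathematicalPhysics.QuantumFieldTheory.Balaban1983to89.B11SectG (BlockNorm HasMaj RowSum)
open Literature.MathematicalPhysics.QuantumFieldTheory.Balaban1983to89.B9Thm312Whole (GeoOK cNorm)
open Literature.MathematicalPhysics.QuantumFieldTheory.Balaban1983to89.B9Thm312WholeClasses (cNormR)
open Literature.MathematicalPhysics.QuantumFieldTheory.Balaban1983to89.B9Thm312WholeLeft (LeftStep)
open Literature.MathematicalPhysics.QuantumFieldTheory.Balaban1983to89.B9Thm312WholeDir (Thm33G0Dir StepDir)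
open Literature.MathematicalPhysics.QuantumFieldTheory.Balaban1983to89.B9Thm313WholeDir (Thm33G0DirR Letters313DM Letters313IM)
open Literature.MathematicalPhysics.QuantumFieldTheory.Balaban1983to89.B9Thm313WholeHolder (Letters313H)
open Literature.MathematicalPhysics.QuantumFieldTheory.Balaban1983to89.B9Thm312WholeL2 (StepL2)
open Literature.MathematicalPhysics.QuantumFieldTheory.Balaban1983to89.B9RWSums343Holder (HolderProbes)
open Literature.MathematicalPhysics.QuantumFieldTheory.Balaban1983to89.B9RWSums343to347Whole (Facts347)
open Literature.MathematicalPhysics.QuantumFieldTheory.Balaban1983to89.B9RWSumsDefinitePins (PinPrims)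
open Literature.MathematicalPhysics.QuantumFieldTheory.Balaban1983to89.B9RWSums347DefiniteFaces (exp261 lemma21Pack_geo9Y)
open Literature.MathematicalPhysics.QuantumFieldTheory.Balaban1983to89.B9PinMembersKLevelV1 (MemberY geo9Y)
open Literature.MathematicalPhysics.QuantumFieldTheory.Balaban1983to89.B9GeoLemma21KLevelV1 (geo9Y_len_pos rowSum261_geo9Y)
open Literature.MathematicalPhysics.QuantumFieldTheory.Balaban1983to89.B9Thm312WholeStepFrom3131 (Letters3131)
open Literature.MathematicalPhysics.QuantumFieldTheory.Balaban1983to89.B9Thm312WholeLeftStepFrom3131 (Letters3131H)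
open Literature.MathematicalPhysics.QuantumFieldTheory.Balaban1983to89.B9Thm312WholeStepDirFrom3131 (Thm33G0DirX)
open Literature.MathematicalPhysics.QuantumFieldTheory.Balaban1983to89.B9Thm312WholeRightStepFrom3131
  (Letters3131R Thm33G0DivR stepDir_of_letters3131LR)

variable {d ℓ : ℕ} {hd : 1 ≤ d + 1} {hL : Odd (ℓ + 1) ∧ 1 < ℓ + 1} {b₀ b₁ : ℝ} {Mstar : ℕ}
variable [∀ x : MemberY d ℓ hd hL b₀ b₁ Mstar, Fintype (geo9Y x).Site]
variable {c35 : ℝ} {bg : MemberY d ℓ hd hL b₀ b₁ Mstar → B9.Backgrounds}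

/-- the β-indexed domination pattern: `a ≤ A`, `κ ≤ κM`, `0 ≤ b ≤ BM` and `2((A + κM·BM)·t·c) ≤ θ` give `2((a + κ·b)·(t·m)·c) ≤ θ·m`. [folklore] -/
private theorem dom_two {a A κ κM b BM t m c θ : ℝ} (ha : a ≤ A) (hκ : κ ≤ κM) (hκM : 0 ≤ κM) (hb0 : 0 ≤ b) (hb : b ≤ BM)
    (ht : 0 ≤ t) (hm : 0 ≤ m) (hc : 0 ≤ c) (hθ : 2 * ((A + κM * BM) * t * c) ≤ θ) : 2 * ((a + κ * b) * (t * m) * c) ≤ θ * m := by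
  have h1 : κ * b ≤ κM * BM := (mul_le_mul_of_nonneg_right hκ hb0).trans (mul_le_mul_of_nonneg_left hb hκM)
  have h2 : a + κ * b ≤ A + κM * BM := add_le_add ha h1
  have h3 : (a + κ * b) * t * c ≤ (A + κM * BM) * t * c := mul_le_mul_of_nonneg_right (mul_le_mul_of_nonneg_right h2 ht) hc
  calc 2 * ((a + κ * b) * (t * m) * c) = 2 * ((a + κ * b) * t * c) * m := by ring
    _ ≤ 2 * ((A + κM * BM) * t * c) * m := mul_le_mul_of_nonneg_right (by linarith only [h3]) hm
    _ ≤ θ * m := mul_le_mul_of_nonneg_right hθ hm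

/-- the β-indexed domination with the lattice factor: `a ≤ A`, `b ≤ B`, `2((A + B)·t·c·L) ≤ θ` give `2((a + b)·(t·m)·c·L) ≤ θ·m`. [folklore] -/
private theorem dom_L {a A b B t m c L θ : ℝ} (ha : a ≤ A) (hb : b ≤ B) (ht : 0 ≤ t) (hm : 0 ≤ m) (hc : 0 ≤ c) (hL : 0 ≤ L)
    (hθ : 2 * ((A + B) * t * c * L) ≤ θ) : 2 * ((a + b) * (t * m) * c * L) ≤ θ * m := by
  have h3 : (a + b) * t * c * L ≤ (A + B) * t * c * L :=
    mul_le_mul_of_nonneg_right (mul_le_mul_of_nonneg_right (mul_le_mul_of_nonneg_right (add_le_add ha hb) ht) hc) hL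
  calc 2 * ((a + b) * (t * m) * c * L) = 2 * ((a + b) * t * c * L) * m := by ring
    _ ≤ 2 * ((A + B) * t * c * L) * m := mul_le_mul_of_nonneg_right (by linarith only [h3]) hm
    _ ≤ θ * m := mul_le_mul_of_nonneg_right hθ hm

/-- the ε-indexed domination: `b ≤ B`, `2((A + B)·t·c) ≤ θ` give `2((A + b)·(t·m)·c) ≤ θ·m`. [folklore] -/
private theorem dom_eps {A b B t m c θ : ℝ} (hb : b ≤ B) (ht : 0 ≤ t) (hm : 0 ≤ m) (hc : 0 ≤ c)
    (hθ : 2 * ((A + B) * t * c) ≤ θ) : 2 * ((A + b) * (t * m) * c) ≤ θ * m := by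
  have h3 : (A + b) * t * c ≤ (A + B) * t * c := mul_le_mul_of_nonneg_right (mul_le_mul_of_nonneg_right (by linarith only [hb]) ht) hc
  calc 2 * ((A + b) * (t * m) * c) = 2 * ((A + b) * t * c) * m := by ring
    _ ≤ 2 * ((A + B) * t * c) * m := mul_le_mul_of_nonneg_right (by linarith only [h3]) hm
    _ ≤ θ * m := mul_le_mul_of_nonneg_right hθ hm

set_option maxHeartbeats 400000 in
/-- ★★ **ROWS 20–21's `StepDir` DERIVED AT def-Y's MEMBERS, AFTER THE G₀ LAYER** (module docstring).  Inputs: `q : PinPrims` (for n06-k's member facts);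
the Hölder probes `𝔭A`, the single-direction letters `Dd ∕ Dds`, the input norm `bHXA`, the Theorem-3.12 letters `𝔬12`, the scalar-field Hölder norm
`bH13` (cutting constant ≦ κ13) and input norms `bHW13`; the geometry facts `hgeo`; the core helper's outputs in its regime (M₀, a₀): `hleft`
(`LeftStep` at θD), `h33` (`Thm33G0Dir` with constants B12₀, Bh12), `h33R` (`Thm33G0DirR`), their signs and the β-uniform bound `hBhM`; the displayed
schemas in Theorem 3.12's regime (M12, a12) with `M12 ≤ M₀`, `a₀ ≤ a12`: `hLH3 hDM hX hdiv hIM hL3131 hL3131H hR hstepL2`; the majorant letters'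
signs and β- ∕ ε-uniform bounds; the rates.  Output: `∃ θD' θH M₀'`, `0 ≤ θD'`, `0 ≤ θH`, `M₀ ≤ M₀'`, and in the regime (M₀′, a₀): `LeftStep` at θD′
and `StepDir θD′ θH δK12 ∧ StepL2`.  Nothing of print asserted.
[cite: Balaban1985BackgroundPropagators, Thm 3.12 p.423 + (3.130)–(3.131) pp.421–422 + (3.137)–(3.138) p.423 + (3.42)–(3.45) pp.397–398 + p.398 + p.421; Balaban1984PropagatorsII, Lemma 2.1 (2.61) p.234 + (2.26) p.228] -/
theorem stepDir_layer_of_letters {X Y PX PY Z W P : MemberY d ℓ hd hL b₀ b₁ Mstar → Type}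
    [∀ x, Fintype (X x)] [∀ x, Fintype (Y x)] [∀ x, Fintype (PX x)] [∀ x, Fintype (PY x)] [∀ x, Fintype (Z x)] [∀ x, Fintype (W x)]
    [∀ x, Fintype (P x)]
    (q : PinPrims) (hq : q.OK) (H : MemberY d ℓ hd hL b₀ b₁ Mstar → Prop)
    (𝔭A : ∀ x : MemberY d ℓ hd hL b₀ b₁ Mstar, HolderProbes (geo9Y x) (bg x) (X x) (Y x) (PX x) (PY x))
    (Dd Dds : ∀ x : MemberY d ℓ hd hL b₀ b₁ Mstar, (bg x).Cfg → P x → Module.End ℝ (X x → ℝ))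
    (bHXA : ∀ x : MemberY d ℓ hd hL b₀ b₁ Mstar, ℝ → BlockNorm (toB6 (geo9Y x) 1 (H x)) (X x → ℝ))
    (𝔬12 : ∀ x : MemberY d ℓ hd hL b₀ b₁ Mstar, B9Thm312Whole.Ops (geo9Y x) (bg x) (X x) (Y x) (Z x) (W x))
    (bH13 : ∀ x : MemberY d ℓ hd hL b₀ b₁ Mstar, BlockNorm (toB6 (geo9Y x) 1 (H x)) (W x → ℝ)) (κ13 : ℝ) (hκ13 : ∀ x, (bH13 x).κ ≤ κ13)
    (bHW13 : ∀ x : MemberY d ℓ hd hL b₀ b₁ Mstar, ℝ → BlockNorm (toB6 (geo9Y x) 1 (H x)) (W x → ℝ))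
    (hgeo : ∀ x : MemberY d ℓ hd hL b₀ b₁ Mstar, GeoOK (geo9Y x))
    -- numerics: the core helper's constants ∕ thresholds and the certificate's rates
    (B12₀ δ12₀ δK12 B12₃ δ12₃ t12 δT12 ρS σS θD θ2₁₂ BhM M₀ a₀ M12 a12 : ℝ) (Bh12 Bi12 Bq12 BhD13 Bx13 Bx0 BdX BiD BdD : ℝ → ℝ)
    (Bi2₁₂ : ℝ → ℝ → ℝ)
    (BhDM BxM Bx0M BdXM BiDM : ℝ)
    (hB12₀ : 0 ≤ B12₀) (hB12₃ : 0 ≤ B12₃) (ht12 : 0 ≤ t12) (hθD : 0 ≤ θD) (hM₀ : 0 < M₀) (hMM : M12 ≤ M₀) (haa : a₀ ≤ a12)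
    (hBh12 : ∀ β, 0 ≤ β → β < 1 → 0 ≤ Bh12 β) (hBhM : ∀ β, 0 ≤ β → β < 1 → Bh12 β ≤ BhM)
    (hBhD13 : ∀ β, 0 ≤ β → β < 1 → 0 ≤ BhD13 β) (hBx13 : ∀ β, 0 ≤ β → β < 1 → 0 ≤ Bx13 β) (hBx0 : ∀ β, 0 ≤ β → β < 1 → 0 ≤ Bx0 β)
    (hBdX : ∀ β, 0 ≤ β → β < 1 → 0 ≤ BdX β) (hBiD : ∀ ε, 0 < ε → 0 ≤ BiD ε)
    (hBhDM : ∀ β, 0 ≤ β → β < 1 → BhD13 β ≤ BhDM) (hBxM : ∀ β, 0 ≤ β → β < 1 → Bx13 β ≤ BxM) (hBx0M : ∀ β, 0 ≤ β → β < 1 → Bx0 β ≤ Bx0M)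
    (hBdXM : ∀ β, 0 ≤ β → β < 1 → BdX β ≤ BdXM) (hBiDM : ∀ ε, 0 < ε → BiD ε ≤ BiDM)
    (hσS : 0 < σS) (hρST : ρS ≤ δT12) (hρS₀ : ρS + σS ≤ δ12₀) (hρS₃ : ρS + σS ≤ δ12₃) (hδK0 : 0 ≤ δK12)
    (hδKS : δK12 + q.αF * ((1 - 2 * q.α) * q.δ₀) ≤ ρS)
    -- the core helper's output families in its regime (M₀, a₀)
    (hleft : ∀ x : MemberY d ℓ hd hL b₀ b₁ Mstar, M₀ ≤ (geo9Y x).M → ∀ α₀ : ℝ, 0 < α₀ → (geo9Y x).M * α₀ ≤ a₀ →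
      ∀ U : (bg x).Cfg, (bg x).Reg335 c35 α₀ U → (bg x).Reg336 c35 α₀ U →
        LeftStep (𝔬12 x) 1 (H x) (fun y => (geo9Y_len_pos x y).le) B12₀ δ12₀ (θD * ((geo9Y x).M * α₀)) δK12 U)
    (h33 : ∀ x : MemberY d ℓ hd hL b₀ b₁ Mstar, M₀ ≤ (geo9Y x).M → ∀ α₀ : ℝ, 0 < α₀ → (geo9Y x).M * α₀ ≤ a₀ →
      ∀ U : (bg x).Cfg, (bg x).Reg335 c35 α₀ U → (bg x).Reg336 c35 α₀ U →
        Thm33G0Dir (𝔬12 x) (𝔭A x) (Dd x) (Dds x) 1 (H x) (bHXA x) B12₀ Bh12 Bi12 Bi2₁₂ δ12₀ U)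
    (h33R : ∀ x : MemberY d ℓ hd hL b₀ b₁ Mstar, M₀ ≤ (geo9Y x).M → ∀ α₀ : ℝ, 0 < α₀ → (geo9Y x).M * α₀ ≤ a₀ →
      ∀ U : (bg x).Cfg, (bg x).Reg335 c35 α₀ U → (bg x).Reg336 c35 α₀ U → Thm33G0DirR (𝔬12 x) (Dds x) 1 (H x) B12₀ δ12₀ U)
    -- the displayed schemas of rows 20–21 in Theorem 3.12's regime (M12, a12)
    (hLH3 : ∀ x : MemberY d ℓ hd hL b₀ b₁ Mstar, M12 ≤ (geo9Y x).M → ∀ α₀ : ℝ, 0 < α₀ → (geo9Y x).M * α₀ ≤ a12 →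
      ∀ U : (bg x).Cfg, (bg x).Reg335 c35 α₀ U → (bg x).Reg336 c35 α₀ U →
        Letters313H (𝔬12 x) (𝔭A x) 1 (H x) (fun y => (geo9Y_len_pos x y).le) (bH13 x) BhD13 Bx13 δ12₃ U)
    (hDM : ∀ x : MemberY d ℓ hd hL b₀ b₁ Mstar, M12 ≤ (geo9Y x).M → ∀ α₀ : ℝ, 0 < α₀ → (geo9Y x).M * α₀ ≤ a12 →
      ∀ U : (bg x).Cfg, (bg x).Reg335 c35 α₀ U → (bg x).Reg336 c35 α₀ U →
        Letters313DM (𝔬12 x) (𝔭A x) (Dd x) 1 (H x) (hgeo x) B12₃ Bq12 δ12₃ (bH13 x) U)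
    (hX : ∀ x : MemberY d ℓ hd hL b₀ b₁ Mstar, M12 ≤ (geo9Y x).M → ∀ α₀ : ℝ, 0 < α₀ → (geo9Y x).M * α₀ ≤ a12 →
      ∀ U : (bg x).Cfg, (bg x).Reg335 c35 α₀ U → (bg x).Reg336 c35 α₀ U →
        Thm33G0DirX (𝔬12 x) (𝔭A x) (Dd x) 1 (H x) (fun y => (geo9Y_len_pos x y).le) (bH13 x) Bx0 BdX δ12₀ δ12₃ U)
    (hdiv : ∀ x : MemberY d ℓ hd hL b₀ b₁ Mstar, M12 ≤ (geo9Y x).M → ∀ α₀ : ℝ, 0 < α₀ → (geo9Y x).M * α₀ ≤ a12 →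
      ∀ U : (bg x).Cfg, (bg x).Reg335 c35 α₀ U → (bg x).Reg336 c35 α₀ U →
        Thm33G0DivR (𝔬12 x) (Dds x) 1 (H x) (fun y => (geo9Y_len_pos x y).le) (bHXA x) (bHW13 x) BiD BdD δ12₀ δ12₃ U)
    (hdomX : ∀ x : MemberY d ℓ hd hL b₀ b₁ Mstar, M12 ≤ (geo9Y x).M → ∀ α₀ : ℝ, 0 < α₀ → (geo9Y x).M * α₀ ≤ a12 →
      ∀ U : (bg x).Cfg, (bg x).Reg335 c35 α₀ U → (bg x).Reg336 c35 α₀ U →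
        ∀ ε : ℝ, 0 < ε → ∀ (y : (geo9Y x).Site) (μ : X x → ℝ),
          (BlockNorm.ofBlocks (toB6 (geo9Y x) 1 (H x)) (𝔬12 x).blk).loc y μ ≤ (bHXA x ε).loc y μ)
    (hlocX : ∀ x : MemberY d ℓ hd hL b₀ b₁ Mstar, M12 ≤ (geo9Y x).M → ∀ α₀ : ℝ, 0 < α₀ → (geo9Y x).M * α₀ ≤ a12 →
      ∀ U : (bg x).Cfg, (bg x).Reg335 c35 α₀ U → (bg x).Reg336 c35 α₀ U →
        ∀ ε : ℝ, 0 < ε → ∀ (y : (geo9Y x).Site) (μ : X x → ℝ),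
          (bHXA x ε).IsLoc y μ → (BlockNorm.ofBlocks (toB6 (geo9Y x) 1 (H x)) (𝔬12 x).blk).IsLoc y μ)
    (Ta Ta₂ Ta' Ta₂' : ∀ x : MemberY d ℓ hd hL b₀ b₁ Mstar, (bg x).Cfg → Module.End ℝ (X x → ℝ))
    (Tb Tb₂ : ∀ x : MemberY d ℓ hd hL b₀ b₁ Mstar, (bg x).Cfg → (X x → ℝ) →ₗ[ℝ] (W x → ℝ))
    (Tb' Tb₂' : ∀ x : MemberY d ℓ hd hL b₀ b₁ Mstar, (bg x).Cfg → (W x → ℝ) →ₗ[ℝ] (X x → ℝ))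
    (hL3131 : ∀ x : MemberY d ℓ hd hL b₀ b₁ Mstar, M12 ≤ (geo9Y x).M → ∀ α₀ : ℝ, 0 < α₀ → (geo9Y x).M * α₀ ≤ a12 →
      ∀ U : (bg x).Cfg, (bg x).Reg335 c35 α₀ U → (bg x).Reg336 c35 α₀ U →
        Letters3131 (𝔬12 x) (Ta x) (Ta₂ x) (Tb x) (Tb₂ x) 1 (H x) (fun y => (geo9Y_len_pos x y).le) (t12 * ((geo9Y x).M * α₀)) δT12 U)
    (hL3131H : ∀ x : MemberY d ℓ hd hL b₀ b₁ Mstar, M12 ≤ (geo9Y x).M → ∀ α₀ : ℝ, 0 < α₀ → (geo9Y x).M * α₀ ≤ a12 →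
      ∀ U : (bg x).Cfg, (bg x).Reg335 c35 α₀ U → (bg x).Reg336 c35 α₀ U →
        Letters3131H (𝔬12 x) (Tb x) (Tb₂ x) 1 (H x) (fun y => (geo9Y_len_pos x y).le) (bH13 x) (t12 * ((geo9Y x).M * α₀)) δT12 U)
    (hR : ∀ x : MemberY d ℓ hd hL b₀ b₁ Mstar, M12 ≤ (geo9Y x).M → ∀ α₀ : ℝ, 0 < α₀ → (geo9Y x).M * α₀ ≤ a12 →
      ∀ U : (bg x).Cfg, (bg x).Reg335 c35 α₀ U → (bg x).Reg336 c35 α₀ U →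
        Letters3131R (𝔬12 x) (Ta' x) (Ta₂' x) (Tb' x) (Tb₂' x) 1 (H x) (fun y => (geo9Y_len_pos x y).le) (t12 * ((geo9Y x).M * α₀)) δT12 U)
    (hstepL2 : ∀ x : MemberY d ℓ hd hL b₀ b₁ Mstar, M12 ≤ (geo9Y x).M → ∀ α₀ : ℝ, 0 < α₀ → (geo9Y x).M * α₀ ≤ a12 →
      ∀ U : (bg x).Cfg, (bg x).Reg335 c35 α₀ U → (bg x).Reg336 c35 α₀ U →
        StepL2 (𝔬12 x) 1 (H x) (θ2₁₂ * ((geo9Y x).M * α₀)) δK12 U) :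
    ∃ θD' θH M₀' : ℝ, 0 ≤ θD' ∧ 0 ≤ θH ∧ M₀ ≤ M₀' ∧
      (∀ x : MemberY d ℓ hd hL b₀ b₁ Mstar, M₀' ≤ (geo9Y x).M → ∀ α₀ : ℝ, 0 < α₀ → (geo9Y x).M * α₀ ≤ a₀ →
        ∀ U : (bg x).Cfg, (bg x).Reg335 c35 α₀ U → (bg x).Reg336 c35 α₀ U →
          LeftStep (𝔬12 x) 1 (H x) (fun y => (geo9Y_len_pos x y).le) B12₀ δ12₀ (θD' * ((geo9Y x).M * α₀)) δK12 U) ∧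
      (∀ x : MemberY d ℓ hd hL b₀ b₁ Mstar, M₀' ≤ (geo9Y x).M → ∀ α₀ : ℝ, 0 < α₀ → (geo9Y x).M * α₀ ≤ a₀ →
        ∀ U : (bg x).Cfg, (bg x).Reg335 c35 α₀ U → (bg x).Reg336 c35 α₀ U →
          StepDir (𝔬12 x) (𝔭A x) (Dd x) (Dds x) 1 (H x) (bHXA x) (fun y => (geo9Y_len_pos x y).le) (θD' * ((geo9Y x).M * α₀))
            (θH * ((geo9Y x).M * α₀)) δK12 U ∧
          StepL2 (𝔬12 x) 1 (H x) (θ2₁₂ * ((geo9Y x).M * α₀)) δK12 U) := by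
  -- p. 398's member facts at ((1 − 2α)δ₀, α_F) and [4] (2.61) at the rate σS, above ONE threshold each (n06-k ∕ n06-i)
  obtain ⟨ML, -, hfacts, -⟩ :=
    lemma21Pack_geo9Y (d := d) (ℓ := ℓ) (hd := hd) (hL := hL) (b₀ := b₀) (b₁ := b₁) (Mstar := Mstar) H hq.α_pos hq.α_lt
      hq.δ₀_pos hq.αF_pos (by linarith only [hq.αF_lt])
  obtain ⟨MLσ, cσ, hrow0⟩ := rowSum261_geo9Y (d := d) (ℓ := ℓ) (hd := hd) (hL := hL) (b₀ := b₀) (b₁ := b₁) (Mstar := Mstar) σS hσS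
  set c : ℝ := max cσ 0 with hc'
  have hc0 : 0 ≤ c := le_max_right _ _
  have hrow : ∀ x : MemberY d ℓ hd hL b₀ b₁ Mstar, MLσ ≤ (geo9Y x).M → RowSum (toB6 (geo9Y x) 1 (H x)) σS c :=
    fun x hM y => (hrow0 x hM y).trans (le_max_left _ _)
  set L₀ : ℝ := ((ℓ + 1 : ℕ) : ℝ) with hL₀
  have hL₀0 : 0 ≤ L₀ := by rw [hL₀]; positivity
  set κM : ℝ := max κ13 0 with hκM
  have hκM0 : 0 ≤ κM := le_max_right _ _
  -- the step constants BY CHOICE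
  set θD' : ℝ := max θD (2 * ((B12₀ + κM * B12₃) * t12 * c)) with hθD'
  set θH : ℝ := max (max (2 * ((BhM + κM * BhDM) * t12 * c)) (2 * ((BhM + κM * BdXM) * t12 * c)))
    (max (2 * ((Bx0M + BxM) * t12 * c * L₀)) (2 * ((B12₀ * L₀ + BiDM) * t12 * c))) with hθH
  set M₀' : ℝ := max M₀ (max ML MLσ) with hM₀'
  have hθD'0 : 0 ≤ θD' := hθD.trans (le_max_left _ _)
  have hBhM0 : 0 ≤ BhM := (hBh12 0 le_rfl one_pos).trans (hBhM 0 le_rfl one_pos)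
  have hBhDM0 : 0 ≤ BhDM := (hBhD13 0 le_rfl one_pos).trans (hBhDM 0 le_rfl one_pos)
  have hθH0 : 0 ≤ θH := le_trans (mul_nonneg (by norm_num) (mul_nonneg (mul_nonneg (add_nonneg hBhM0 (mul_nonneg hκM0 hBhDM0)) ht12) hc0))
    ((le_max_left _ _).trans (le_max_left _ _))
  have hαFδ : 0 ≤ q.αF * ((1 - 2 * q.α) * q.δ₀) :=
    mul_nonneg hq.αF_pos.le (mul_nonneg (by linarith only [hq.α_lt]) hq.δ₀_pos.le)
  refine ⟨θD', θH, M₀', hθD'0, hθH0, le_max_left _ _, fun x hM α₀ hα ha U hU hU' => ?_, fun x hM α₀ hα ha U hU hU' => ?_⟩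
  all_goals
    have hM0x : M₀ ≤ (geo9Y x).M := (le_max_left _ _).trans hM
    have hM12x : M12 ≤ (geo9Y x).M := hMM.trans hM0x
    have hMLx : ML ≤ (geo9Y x).M := ((le_max_left _ _).trans (le_max_right _ _)).trans hM
    have hMLσx : MLσ ≤ (geo9Y x).M := ((le_max_right _ _).trans (le_max_right _ _)).trans hM
    have ha12x : (geo9Y x).M * α₀ ≤ a12 := ha.trans haa
    have hMpos : 0 < (geo9Y x).M := lt_of_lt_of_le hM₀ hM0x
    have hMα : 0 ≤ (geo9Y x).M * α₀ := mul_nonneg hMpos.le hα.le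
    have hw : ∀ a b : (geo9Y x).Site, θD * ((geo9Y x).M * α₀) * Real.exp (-(δK12 * (toB6 (geo9Y x) 1 (H x)).dist a b)) ≤
        θD' * ((geo9Y x).M * α₀) * Real.exp (-(δK12 * (toB6 (geo9Y x) 1 (H x)).dist a b)) := fun a b =>
      mul_le_mul_of_nonneg_right (mul_le_mul_of_nonneg_right (le_max_left _ _) hMα) (Real.exp_nonneg _)
  · obtain ⟨he1, hsd, hsd1⟩ := hleft x hM0x α₀ hα ha U hU hU'
    exact ⟨he1, hsd.mono hw, hsd1.mono hw⟩
  · have hκx : (bH13 x).κ ≤ κM := (hκ13 x).trans (le_max_left _ _)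
    have hS := stepDir_of_letters3131LR (R₀ := 1) (H₀ := H x) (hgeo x) (hfacts x hMLx) (hrow x hMLσx) hc0 hB12₀ hB12₃
      (mul_nonneg ht12 hMα) hBh12 hBhD13 hBx13 hBx0 hBdX hBiD hρST hρS₀ hρS₃ hαFδ hδK0 hδKS
      (θD := θD' * ((geo9Y x).M * α₀)) (θH := θH * ((geo9Y x).M * α₀))
      (dom_two le_rfl hκx hκM0 hB12₃ le_rfl ht12 hMα hc0 (le_max_right _ _))
      (fun β hβ0 hβ1 => dom_two (hBhM β hβ0 hβ1) hκx hκM0 (hBhD13 β hβ0 hβ1) (hBhDM β hβ0 hβ1) ht12 hMα hc0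
        ((le_max_left _ _).trans (le_max_left _ _)))
      (fun β hβ0 hβ1 => dom_two (hBhM β hβ0 hβ1) hκx hκM0 (hBdX β hβ0 hβ1) (hBdXM β hβ0 hβ1) ht12 hMα hc0
        ((le_max_right _ _).trans (le_max_left _ _)))
      (fun β hβ0 hβ1 => dom_L (hBx0M β hβ0 hβ1) (hBxM β hβ0 hβ1) ht12 hMα hc0 hL₀0 ((le_max_left _ _).trans (le_max_right _ _)))
      (fun ε hε => dom_eps (hBiDM ε hε) ht12 hMα hc0 ((le_max_right _ _).trans (le_max_right _ _)))
      (h33 x hM0x α₀ hα ha U hU hU') (h33R x hM0x α₀ hα ha U hU hU') (hLH3 x hM12x α₀ hα ha12x U hU hU')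
      (hDM x hM12x α₀ hα ha12x U hU hU') (hX x hM12x α₀ hα ha12x U hU hU') (hdiv x hM12x α₀ hα ha12x U hU hU')
      (hdomX x hM12x α₀ hα ha12x U hU hU') (hlocX x hM12x α₀ hα ha12x U hU hU') (hL3131 x hM12x α₀ hα ha12x U hU hU')
      (hL3131H x hM12x α₀ hα ha12x U hU hU') (hR x hM12x α₀ hα ha12x U hU hU')
    exact ⟨hS, hstepL2 x hM12x α₀ hα ha12x U hU hU'⟩

end Summit.QuantumFields.YangMills.BalabanUVNodes.N06StepDirLayerAtPins

end
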